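import Mathlib
import Summits.CriticalPhenomena.CardyFormulaZ2.Theorems.CardySelfRefinementGradientComparabilityStubDcEqSumPivotal
import HarnessLib

/-!
# Kesten window on the independent slice `ρ = 0`: the slice dictionary and the reduction

Crux `stmt-CriticalPhenomena-10269`
(`Summit.CriticalPhenomena.CardyFormulaZ2.Theses.CardySelfRefinement.GradientComparability`),
line `monotone-product-coordinates`, stub `stub_windowAtRhoZero` (Kesten's near-critical
stability of `∂cP(0,·)` across the level window `{c : P_η(0,c) ∈ [vlo,vhi]}`, mesh-uniformly).
Vocabulary (`ax prm cfg M P Dc window Aloc edgeOf …`) from `CardySelfRefinementDefs`.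

## Mathematics

On the slice `ρ = 0` every selector coin has bias `projIcc 0 = 0`, so the read-out `cfg k` is
a.s. its monotone shadow (`M_zero_eq_map_shadow`) and, marginalising the unread shared and
selector coins (`prodBernoulli_refinementParam_map_ownLayer`), **`M_k(0,c)` is the `k`-periodic
inhomogeneous INDEPENDENT Bernoulli bond percolation on `ℤ²`**: the push-forward under the edge
labelling `edgeConfig` of the EDGE-indexed product coin measure with bias `½` on the axial edges
(those on the lines of `kℤ²`) and `projIcc c` on all other edges (`M_zero_eq_map_edgeConfig`).
Consequently (`stub_Dc_eq_sum_pivotal`, Russo's formula in the `c`-direction) the Russo derivative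
on the slice is the pivotal sum of a genuine product measure,
`∂cP(0,c) = Σ_{non-axial e ∈ window} μ_{k,c}(e pivotal for Aloc)` (`Dc_zero_eq_sum_pivotal_slice`,
`hasDerivWithinAt_P_zero`), and the level is `P_η(0,c) = μ_{k,c}(Aloc)` (`P_zero_eq_real_slice`).

Hence the stub is EQUIVALENT (`stub_windowAtRhoZero_of_sliceStability`,
`sliceStability_of_windowAtRhoZero`) to the following statement of near-critical percolation
theory for the `k`-periodic inhomogeneous Bernoulli bond model `μ_{k,c}` (Kesten 1987, Thm. 1 /
Lemma 8 and (4.5); Nolin 2008, Thm. 27 with Prop. 34; Duminil-Copin–Manolescu–Tassion 2021,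
Thm. 1.2, all printed for the HOMOGENEOUS model): *for every nonempty finite quad family and
levels `0 < vlo < vhi < 1` there are `Λ`, `η₁ > 0` such that for every mesh `η < η₁` the pivotal
sum `Σ_{non-axial window e} μ_{k,c}(e pivotal for Aloc)` varies by at most the factor `Λ` over the
level window `{c ∈ [0,1] : μ_{k,c}(Aloc) ∈ [vlo,vhi]}`* — the hypothesis `hK` below, stated
def-free over the Defs vocabulary with the slice law bound as `μ`.  Its homogeneous bond-`ℤ²`
ingredients are the tree's UNPROVED named facts `Kesten1987_zdFourArmStability` and
`Kesten1987_zdPivotalCount_sameParam` (`Literature/Probability/Percolation/ZdKestenRelationInputs`);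
no `k`-periodic version exists in the tree, which is why the stub itself is not closed here.
-/

noncomputable section

namespace Summit.CriticalPhenomena.CardyFormulaZ2.Theorems.CardySelfRefinement

open scoped Topology
open Filter Set MeasureTheory
open Literature.Probability.LatticeModels Literature.Probability.Percolation
open Literature.Probability.Percolation.QuadCrossing
open Summit.CriticalPhenomena.CardyFormulaZ2.Theses.CardySelfRefinement

/-! ## The slice `ρ = 0` is `k`-periodic inhomogeneous Bernoulli bond percolation -/

/-- On the slice `ρ = 0` the own coin of the fine edge `e` has bias `½` if `e` is axial and
`projIcc c` otherwise. -/
theorem prm_zero_own (k : ℕ) (c : ℝ) (e : Site 2 × Fin 2) :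
    prm k 0 c (e.1, e.2, 0) = if ax k e then half else Set.projIcc (0 : ℝ) 1 zero_le_one c := by
  rfl

/-- **Slice dictionary.**  `M_k(0,c)` is the push-forward under the edge labelling `edgeConfig` of
the EDGE-indexed product coin measure with bias `½` on axial and `projIcc c` on non-axial edges
(independent inhomogeneous bond percolation on `ℤ²`, `k`-periodic). -/
theorem M_zero_eq_map_edgeConfig (k : ℕ) (c : ℝ) :
    M k 0 c = (prodBernoulli fun e : Site 2 × Fin 2 =>
      if ax k e then half else Set.projIcc (0 : ℝ) 1 zero_le_one c).map edgeConfig := by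
  rw [M_zero_eq_map_shadow, ← Measure.map_map measurable_edgeConfig measurable_ownLayer]
  congr 1
  exact prodBernoulli_refinementParam_map_ownLayer k 0 c

/-- At `c = ½` the slice model is critical Bernoulli bond percolation on `ℤ²` (every bias is `½`). -/
theorem sliceLaw_half (k : ℕ) :
    (prodBernoulli fun e : Site 2 × Fin 2 =>
      if ax k e then half else Set.projIcc (0 : ℝ) 1 zero_le_one (1 / 2)).map edgeConfig =
      bondPercolation (zdGraph 2) half := by
  rw [← M_zero_eq_map_edgeConfig]
  exact selfRefinementMeasure_zero_half k

/-- The level on the slice: `P_η(0,c)` is the probability of the localised joint crossing event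
`Aloc` under the `k`-periodic inhomogeneous bond model. -/
theorem P_zero_eq_real_slice (k m : ℕ) (F : Fin m → Quad (Set.univ : Set ℂ)) (η c : ℝ) :
    P k m F η 0 c = ((prodBernoulli fun e : Site 2 × Fin 2 =>
      if ax k e then half else Set.projIcc (0 : ℝ) 1 zero_le_one c).map edgeConfig).real
        (Aloc m F η) := by
  rw [P_eq_real_Aloc, M_zero_eq_map_edgeConfig]

/-- The finite set of NON-axial window edges exists (the window is finite for `η ≠ 0`). -/
theorem exists_nonAxialWindow (k m : ℕ) (F : Fin m → Quad (Set.univ : Set ℂ)) {η : ℝ} (hη : η ≠ 0) :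
    ∃ W : Finset (Sym2 (Site 2)), ∀ e, e ∈ W ↔
      e ∈ window m F η ∧ ∃ (v : Site 2) (d : Fin 2), e = edgeOf (v, d) ∧ ¬ ax k (v, d) := by
  classical
  refine ⟨(window_finite m F hη).toFinset.filter
    (fun e => ∃ (v : Site 2) (d : Fin 2), e = edgeOf (v, d) ∧ ¬ ax k (v, d)), fun e => ?_⟩
  rw [Finset.mem_filter, Set.Finite.mem_toFinset]

/-- **Russo on the slice (pivotal-sum form).**  For `η ≠ 0` and `c ∈ [0,1]`,
`∂cP(0,c) = Σ_{non-axial e ∈ window} μ_{k,c}(e pivotal for Aloc)` with `μ_{k,c}` the `k`-periodic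
inhomogeneous bond model (a genuine product measure read through `edgeConfig`). -/
theorem Dc_zero_eq_sum_pivotal_slice (k m : ℕ) (F : Fin m → Quad (Set.univ : Set ℂ)) {η : ℝ}
    (hη : η ≠ 0) {c : ℝ} (hc : c ∈ Set.Icc (0 : ℝ) 1) (W : Finset (Sym2 (Site 2)))
    (hW : ∀ e, e ∈ W ↔ e ∈ window m F η ∧ ∃ (v : Site 2) (d : Fin 2), e = edgeOf (v, d) ∧ ¬ ax k (v, d)) :
    Dc k m F η (0, c) = ∑ e ∈ W, ((prodBernoulli fun e : Site 2 × Fin 2 =>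
      if ax k e then half else Set.projIcc (0 : ℝ) 1 zero_le_one c).map edgeConfig).real
        {ω | IsPivotal (Aloc m F η) e ω} := by
  rw [stub_Dc_eq_sum_pivotal k m F hη 0 hc W hW, M_zero_eq_map_edgeConfig]

/-- **Russo on the slice (derivative form).**  For `η ≠ 0` and `c ∈ [0,1]`, the level
`c' ↦ P_η(0,c')` has, within `[0,1]` at `c`, the derivative
`Σ_{non-axial e ∈ window} μ_{k,c}(e pivotal for Aloc)`. -/
theorem hasDerivWithinAt_P_zero (k m : ℕ) (F : Fin m → Quad (Set.univ : Set ℂ)) {η : ℝ}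
    (hη : η ≠ 0) {c : ℝ} (hc : c ∈ Set.Icc (0 : ℝ) 1) (W : Finset (Sym2 (Site 2)))
    (hW : ∀ e, e ∈ W ↔ e ∈ window m F η ∧ ∃ (v : Site 2) (d : Fin 2), e = edgeOf (v, d) ∧ ¬ ax k (v, d)) :
    HasDerivWithinAt (fun c' => P k m F η 0 c')
      (∑ e ∈ W, ((prodBernoulli fun e : Site 2 × Fin 2 =>
        if ax k e then half else Set.projIcc (0 : ℝ) 1 zero_le_one c).map edgeConfig).real
          {ω | IsPivotal (Aloc m F η) e ω}) (Set.Icc 0 1) c := by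
  obtain ⟨Φ, hΦ, hPΦ⟩ := exists_contDiff_eq_P k m F hη
  have h0 : (0 : ℝ) ∈ Set.Icc (0 : ℝ) 1 := ⟨le_rfl, zero_le_one⟩
  -- `P(0,·)` agrees on `[0,1]` with the `C¹` function `Φ (0, ·)`
  have hΦd : HasDerivAt (fun c' : ℝ => Φ (0, c')) (deriv (fun c' : ℝ => Φ (0, c')) c) c := by
    have hd : Differentiable ℝ fun c' : ℝ => Φ (0, c') :=
      (hΦ.differentiable one_ne_zero).comp ((differentiable_const _).prodMk differentiable_id)
    exact (hd c).hasDerivAt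
  have hPd : HasDerivWithinAt (fun c' => P k m F η 0 c') (deriv (fun c' : ℝ => Φ (0, c')) c)
      (Set.Icc 0 1) c :=
    hΦd.hasDerivWithinAt.congr_of_mem (fun c' hc' => hPΦ 0 h0 c' hc') hc
  have hDc : Dc k m F η (0, c) = deriv (fun c' : ℝ => Φ (0, c')) c :=
    hPd.derivWithin (uniqueDiffOn_Icc zero_lt_one c hc)
  rw [← Dc_zero_eq_sum_pivotal_slice k m F hη hc W hW, hDc]
  exact hPd

/-! ## The reduction: the stub is Kesten's window stability for the slice model -/

/-- **`stub_windowAtRhoZero` from Kesten's near-critical stability of the pivotal sum for the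
`k`-periodic inhomogeneous Bernoulli bond model** (hypothesis `hK`, the slice law bound as `μ`):
rewrite the level `P_η(0,c) = μ_{k,c}(Aloc)` and the derivative
`∂cP(0,c) = Σ_{non-axial window e} μ_{k,c}(e pivotal)` through the slice dictionary. -/
theorem stub_windowAtRhoZero_of_sliceStability :
    (∀ k : ℕ, k = 2 ∨ k = 3 → ∀ μ : ℝ → Measure (BondConfig (Site 2)),
      (∀ c, μ c = (prodBernoulli fun e : Site 2 × Fin 2 =>
        if ax k e then half else Set.projIcc (0 : ℝ) 1 zero_le_one c).map edgeConfig) →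
      ∀ (m : ℕ) (F : Fin m → Quad (Set.univ : Set ℂ)), 0 < m →
        ∀ vlo vhi : ℝ, 0 < vlo → vlo < vhi → vhi < 1 →
          ∃ Λ η₁ : ℝ, 0 < η₁ ∧ ∀ η ∈ Set.Ioo 0 η₁, ∀ W : Finset (Sym2 (Site 2)),
            (∀ e, e ∈ W ↔ e ∈ window m F η ∧
              ∃ (v : Site 2) (d : Fin 2), e = edgeOf (v, d) ∧ ¬ ax k (v, d)) →
            ∀ c ∈ Set.Icc (0 : ℝ) 1, ∀ c' ∈ Set.Icc (0 : ℝ) 1,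
              (μ c).real (Aloc m F η) ∈ Set.Icc vlo vhi → (μ c').real (Aloc m F η) ∈ Set.Icc vlo vhi →
                ∑ e ∈ W, (μ c).real {ω | IsPivotal (Aloc m F η) e ω} ≤
                  Λ * ∑ e ∈ W, (μ c').real {ω | IsPivotal (Aloc m F η) e ω}) →
    ∀ k : ℕ, k = 2 ∨ k = 3 → ∀ (m : ℕ) (F : Fin m → Quad (Set.univ : Set ℂ)), 0 < m →
      ∀ vlo vhi : ℝ, 0 < vlo → vlo < vhi → vhi < 1 →
        ∃ Λ η₁ : ℝ, 0 < η₁ ∧ ∀ η ∈ Set.Ioo 0 η₁, ∀ c ∈ Set.Icc (0 : ℝ) 1, ∀ c' ∈ Set.Icc (0 : ℝ) 1,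
          P k m F η 0 c ∈ Set.Icc vlo vhi → P k m F η 0 c' ∈ Set.Icc vlo vhi →
            Dc k m F η (0, c) ≤ Λ * Dc k m F η (0, c') := by
  intro hK k hk m F hm vlo vhi hvlo hvv hvhi
  obtain ⟨Λ, η₁, hη₁, H⟩ := hK k hk (fun c => M k 0 c) (fun c => M_zero_eq_map_edgeConfig k c)
    m F hm vlo vhi hvlo hvv hvhi
  refine ⟨Λ, η₁, hη₁, fun η hη c hc c' hc' hP hP' => ?_⟩
  have hη0 : η ≠ 0 := hη.1.ne'
  obtain ⟨W, hW⟩ := exists_nonAxialWindow k m F hη0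
  rw [stub_Dc_eq_sum_pivotal k m F hη0 0 hc W hW, stub_Dc_eq_sum_pivotal k m F hη0 0 hc' W hW]
  exact H η hη W hW c hc c' hc' (by rwa [← P_eq_real_Aloc]) (by rwa [← P_eq_real_Aloc])

/-- **The stub from stability AGAINST THE CRITICAL POINT** (the printed shape: Kesten 1987,
Lemma 8 / Nolin 2008, Thm. 27 compare `P̂_p` with `P_{1/2}` below the characteristic length): if for
every `c` in the level window the pivotal sum under `μ_{k,c}` is comparable, up to a mesh-uniform
factor `C`, with the pivotal sum under CRITICAL bond percolation `P_{1/2}` (`= μ_{k,½}`,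
`sliceLaw_half`), then the stub holds with `Λ = C²`. -/
theorem stub_windowAtRhoZero_of_sliceStabilityAtHalf :
    (∀ k : ℕ, k = 2 ∨ k = 3 → ∀ μ : ℝ → Measure (BondConfig (Site 2)),
      (∀ c, μ c = (prodBernoulli fun e : Site 2 × Fin 2 =>
        if ax k e then half else Set.projIcc (0 : ℝ) 1 zero_le_one c).map edgeConfig) →
      ∀ (m : ℕ) (F : Fin m → Quad (Set.univ : Set ℂ)), 0 < m →
        ∀ vlo vhi : ℝ, 0 < vlo → vlo < vhi → vhi < 1 →
          ∃ C η₁ : ℝ, 0 < η₁ ∧ ∀ η ∈ Set.Ioo 0 η₁, ∀ W : Finset (Sym2 (Site 2)),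
            (∀ e, e ∈ W ↔ e ∈ window m F η ∧
              ∃ (v : Site 2) (d : Fin 2), e = edgeOf (v, d) ∧ ¬ ax k (v, d)) →
            ∀ c ∈ Set.Icc (0 : ℝ) 1, (μ c).real (Aloc m F η) ∈ Set.Icc vlo vhi →
              ∑ e ∈ W, (μ c).real {ω | IsPivotal (Aloc m F η) e ω} ≤
                  C * ∑ e ∈ W, (bondPercolation (zdGraph 2) half).real
                    {ω | IsPivotal (Aloc m F η) e ω} ∧
                ∑ e ∈ W, (bondPercolation (zdGraph 2) half).real {ω | IsPivotal (Aloc m F η) e ω} ≤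
                  C * ∑ e ∈ W, (μ c).real {ω | IsPivotal (Aloc m F η) e ω}) →
    ∀ k : ℕ, k = 2 ∨ k = 3 → ∀ (m : ℕ) (F : Fin m → Quad (Set.univ : Set ℂ)), 0 < m →
      ∀ vlo vhi : ℝ, 0 < vlo → vlo < vhi → vhi < 1 →
        ∃ Λ η₁ : ℝ, 0 < η₁ ∧ ∀ η ∈ Set.Ioo 0 η₁, ∀ c ∈ Set.Icc (0 : ℝ) 1, ∀ c' ∈ Set.Icc (0 : ℝ) 1,
          P k m F η 0 c ∈ Set.Icc vlo vhi → P k m F η 0 c' ∈ Set.Icc vlo vhi →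
            Dc k m F η (0, c) ≤ Λ * Dc k m F η (0, c') := by
  intro hK
  refine stub_windowAtRhoZero_of_sliceStability fun k hk μ hμ m F hm vlo vhi hvlo hvv hvhi => ?_
  obtain ⟨C, η₁, hη₁, H⟩ := hK k hk μ hμ m F hm vlo vhi hvlo hvv hvhi
  refine ⟨C * C, η₁, hη₁, fun η hη W hW c hc c' hc' hP hP' => ?_⟩
  obtain ⟨h1, -⟩ := H η hη W hW c hc hP
  obtain ⟨-, h2⟩ := H η hη W hW c' hc' hP'
  have h0 : 0 ≤ ∑ e ∈ W, (bondPercolation (zdGraph 2) half).real {ω | IsPivotal (Aloc m F η) e ω} :=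
    Finset.sum_nonneg fun _ _ => measureReal_nonneg
  have h0' : 0 ≤ ∑ e ∈ W, (μ c').real {ω | IsPivotal (Aloc m F η) e ω} :=
    Finset.sum_nonneg fun _ _ => measureReal_nonneg
  rcases le_or_gt 0 C with hC | hC
  · calc ∑ e ∈ W, (μ c).real {ω | IsPivotal (Aloc m F η) e ω}
        ≤ C * ∑ e ∈ W, (bondPercolation (zdGraph 2) half).real {ω | IsPivotal (Aloc m F η) e ω} := h1
      _ ≤ C * (C * ∑ e ∈ W, (μ c').real {ω | IsPivotal (Aloc m F η) e ω}) :=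
          mul_le_mul_of_nonneg_left h2 hC
      _ = C * C * ∑ e ∈ W, (μ c').real {ω | IsPivotal (Aloc m F η) e ω} := by ring
  · calc ∑ e ∈ W, (μ c).real {ω | IsPivotal (Aloc m F η) e ω}
        ≤ C * ∑ e ∈ W, (bondPercolation (zdGraph 2) half).real {ω | IsPivotal (Aloc m F η) e ω} := h1
      _ ≤ 0 := mul_nonpos_of_nonpos_of_nonneg hC.le h0
      _ ≤ C * C * ∑ e ∈ W, (μ c').real {ω | IsPivotal (Aloc m F η) e ω} :=
          mul_nonneg (mul_self_nonneg C) h0'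

/-- **Conversely, the stub implies Kesten's window stability for the slice model**: the two
statements are equivalent reformulations of each other through the slice dictionary. -/
theorem sliceStability_of_windowAtRhoZero :
    (∀ k : ℕ, k = 2 ∨ k = 3 → ∀ (m : ℕ) (F : Fin m → Quad (Set.univ : Set ℂ)), 0 < m →
      ∀ vlo vhi : ℝ, 0 < vlo → vlo < vhi → vhi < 1 →
        ∃ Λ η₁ : ℝ, 0 < η₁ ∧ ∀ η ∈ Set.Ioo 0 η₁, ∀ c ∈ Set.Icc (0 : ℝ) 1, ∀ c' ∈ Set.Icc (0 : ℝ) 1,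
          P k m F η 0 c ∈ Set.Icc vlo vhi → P k m F η 0 c' ∈ Set.Icc vlo vhi →
            Dc k m F η (0, c) ≤ Λ * Dc k m F η (0, c')) →
    ∀ k : ℕ, k = 2 ∨ k = 3 → ∀ μ : ℝ → Measure (BondConfig (Site 2)),
      (∀ c, μ c = (prodBernoulli fun e : Site 2 × Fin 2 =>
        if ax k e then half else Set.projIcc (0 : ℝ) 1 zero_le_one c).map edgeConfig) →
      ∀ (m : ℕ) (F : Fin m → Quad (Set.univ : Set ℂ)), 0 < m →
        ∀ vlo vhi : ℝ, 0 < vlo → vlo < vhi → vhi < 1 →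
          ∃ Λ η₁ : ℝ, 0 < η₁ ∧ ∀ η ∈ Set.Ioo 0 η₁, ∀ W : Finset (Sym2 (Site 2)),
            (∀ e, e ∈ W ↔ e ∈ window m F η ∧
              ∃ (v : Site 2) (d : Fin 2), e = edgeOf (v, d) ∧ ¬ ax k (v, d)) →
            ∀ c ∈ Set.Icc (0 : ℝ) 1, ∀ c' ∈ Set.Icc (0 : ℝ) 1,
              (μ c).real (Aloc m F η) ∈ Set.Icc vlo vhi → (μ c').real (Aloc m F η) ∈ Set.Icc vlo vhi →
                ∑ e ∈ W, (μ c).real {ω | IsPivotal (Aloc m F η) e ω} ≤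
                  Λ * ∑ e ∈ W, (μ c').real {ω | IsPivotal (Aloc m F η) e ω} := by
  intro hW0 k hk μ hμ m F hm vlo vhi hvlo hvv hvhi
  obtain ⟨Λ, η₁, hη₁, H⟩ := hW0 k hk m F hm vlo vhi hvlo hvv hvhi
  refine ⟨Λ, η₁, hη₁, fun η hη W hW c hc c' hc' hP hP' => ?_⟩
  have hη0 : η ≠ 0 := hη.1.ne'
  have hμM : ∀ b, μ b = M k 0 b := fun b => by rw [hμ, M_zero_eq_map_edgeConfig]
  rw [hμM] at hP hP' ⊢
  rw [hμM, ← stub_Dc_eq_sum_pivotal k m F hη0 0 hc W hW, ← stub_Dc_eq_sum_pivotal k m F hη0 0 hc' W hW]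
  exact H η hη c hc c' hc' (by rwa [P_eq_real_Aloc]) (by rwa [P_eq_real_Aloc])

end Summit.CriticalPhenomena.CardyFormulaZ2.Theorems.CardySelfRefinement

end
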